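import Summits.HodgeConjecture.CorCM.DecicCurveFivefoldWeilAiming
import Summits.HodgeConjecture.CorCM.DihedralSexticPairFrameTransfer
import Summits.HodgeConjecture.CorCM.CyclicSexticCMTypes
import Literature.AlgebraicGeometry.Motives.ZarhinHodgeGroupAutC
import HarnessLib

/-!
# COR-CM — the CYCLIC FRAME of a Galois CM field of degree `10`: generator `σ` with `σ⁵ = ρ`, coordinates `p ∘ σⁿ` on the
# complex embeddings, realisers of the translations in `Aut(ℂ)`, and the PARITY LAW for the restriction to the imaginary
# quadratic subfield

Cell `pub-hodgecm2` (COR-CM), seat b09 gen 18 (2026-08-21); count-neutral own lane DECIC-EB0 (lit-andre-3's prover-lane ask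
A6-R22); theorems only, no definition, no named fact, no `sorry`; nothing about abelian varieties or Hodge classes is asserted
here.  Seat b24's `CorCM/CyclicSexticCMTypes.lean` pattern at degree `10` (its `emb σ p n = p ∘ σⁿ`, `conjGal`,
`AndreProductForm.comp_gal_bijective` are used BY NAME), supplying the frame hypotheses `he_sign`/`he_conj`/`he_gal` of
`CorCM/DecicCurveFivefoldFrameTransfer.lean` for every Galois decic CM field; consumed by
`CorCM/DecicCurveFivefoldHodgeOfMarkmanCyclic.lean`.

* §1 `exists_generator_ten` — `Gal(F/ℚ)` is cyclic of order `10`, generated by `σ` with `σ⁵ = ρ` (complex conjugation is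
  central of order `2`, Cauchy gives order `5`; so `D₅`, with trivial centre, is not a CM Galois group: the decic Galois CM
  fields are exactly the cyclic ones); `pow_five_eq_conjGal` — conversely EVERY generator has `σ⁵ = ρ`;
* §2 coordinates modulo `10`: `emb_mod_ten`, `exists_emb_eq_ten`, `emb_eq_emb_iff_ten`, `conjugate_emb_ten`, and the realisers
  `exists_ringEquiv_comp_emb` (an automorphism of `ℂ` extending `σᵍ` through `p` shifts every coordinate by `g`,
  `Motives.ZarhinLie.exists_ringEquiv_complex_comp_eq`);
* §3 **`exists_cyclicFrame`** — for a generator `σ`, a base embedding `p` and an imaginary quadratic `k →ᵢ F` with `p|_k = τ̄`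
  (`τ(δ) = i√d`): a bijection `e : Hom(F, ℂ) ≃ ℤ/10` with `e (p ∘ σⁿ) = n`, complex conjugation `+5`, every translation
  realised in `Aut(ℂ)`, and **`s|_k = τ ⟺ e s` odd** — the PARITY LAW, proved without the Galois correspondence: the
  realisers permute `{τ, τ̄}`, so the restriction pattern `n ↦ [(p ∘ σⁿ)|_k = τ]` is either `1`-periodic (absurd, since `τ`
  does extend to `F`: `card_filter_comp_eq_five`) or alternating (`parity_of_step`, a finite check on `ℤ/10 → Bool`).
[cite: Dodson1984, §1.1 (Imprimitivity Theorem: `ρ` central) and §5.1] [cite: Shimura1998, §8.4 (cyclic CM types)]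

## References
* [Dodson1984] B. Dodson, *The structure of Galois groups of CM-fields*, Trans. AMS 283 (1984) 1–32, §1.1, §5.1.
* [Shimura1998] G. Shimura, *Abelian Varieties with Complex Multiplication and Modular Functions* (1998), §8.2, §8.4.
-/


noncomputable section

open CategoryTheory CategoryTheory.Limits NumberField

namespace Summit.HodgeConjecture.CorCM.DecicCurveFivefold

open Literature.AlgebraicGeometry Literature.AlgebraicGeometry.Motives Literature.AlgebraicGeometry.HodgeTheory
open Literature.AlgebraicGeometry.ComplexMultiplication (IsCMTypeRealisation)
open Literature.NumberTheory.ComplexMultiplication (conjGal conjGal_apply conjGal_mul_conjGal commute_conjGal)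
open Summit.HodgeConjecture.CorCM.CyclicSextic (emb emb_apply emb_zero emb_comp_pow conjugate_eq_comp_conjGal
  orderOf_conjGal)
open Summit.HodgeConjecture.CorCM.DihedralSexticPair (eq_or_eq_conjugate)

/-! ## §1 A Galois CM field of degree `10` has cyclic Galois group -/

section Galois

variable {F : Type} [Field F] [NumberField F] [IsCMField F] [IsGalois ℚ F]

omit [IsCMField F] in
/-- For `F` Galois of degree `10`, `Gal(F/ℚ)` has `10` elements. [folklore] -/
theorem card_gal_eq_ten (h10 : Module.finrank ℚ F = 10) : Nat.card (F ≃ₐ[ℚ] F) = 10 :=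
  (IsGalois.card_aut_eq_finrank ℚ F).trans h10

/-- **A Galois CM field of degree `10` has cyclic Galois group**, generated by an element `σ` of order `10` with `σ⁵ = ρ`
(complex conjugation): `ρ` is central of order `2`, an element of order `5` exists (Cauchy), and the product of two
commuting elements of coprime orders `2`, `5` has order `10`.  (So `D₅`, with trivial centre, is not the group of a CM
field: the decic Galois CM fields are exactly the cyclic ones.) [cite: Dodson1984, §1.1 (Imprimitivity: `ρ` central)] -/
theorem exists_generator_ten (h10 : Module.finrank ℚ F = 10) :
    ∃ σ : F ≃ₐ[ℚ] F, orderOf σ = 10 ∧ σ ^ 5 = conjGal := by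
  classical
  have hcard : Fintype.card (F ≃ₐ[ℚ] F) = 10 := by
    rw [← Nat.card_eq_fintype_card]; exact card_gal_eq_ten h10
  haveI : Fact (Nat.Prime 5) := ⟨by norm_num⟩
  obtain ⟨g, hg⟩ := exists_prime_orderOf_dvd_card 5 (show 5 ∣ Fintype.card (F ≃ₐ[ℚ] F) by
    rw [hcard]; norm_num)
  have hcomm : Commute g (conjGal : F ≃ₐ[ℚ] F) := (commute_conjGal g).symm
  have hcop : (orderOf g).Coprime (orderOf (conjGal : F ≃ₐ[ℚ] F)) := by
    rw [hg, orderOf_conjGal]; decide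
  refine ⟨g * conjGal, ?_, ?_⟩
  · rw [hcomm.orderOf_mul_eq_mul_orderOf_of_coprime hcop, hg, orderOf_conjGal]
  · rw [hcomm.mul_pow, pow_succ (conjGal : F ≃ₐ[ℚ] F) 4,
      show (conjGal : F ≃ₐ[ℚ] F) ^ 4 = ((conjGal : F ≃ₐ[ℚ] F) ^ 2) ^ 2 by rw [← pow_mul],
      ← orderOf_conjGal (K := F), pow_orderOf_eq_one, one_pow, one_mul, ← hg, pow_orderOf_eq_one, one_mul]

/-- Hence `Gal(F/ℚ)` is cyclic. [cite: Dodson1984, §1.1] -/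
theorem isCyclic_gal_ten (h10 : Module.finrank ℚ F = 10) : IsCyclic (F ≃ₐ[ℚ] F) := by
  obtain ⟨σ, hσ, -⟩ := exists_generator_ten h10
  exact isCyclic_of_orderOf_eq_card σ (by rw [hσ, card_gal_eq_ten h10])

/-- **Every generator has `σ⁵ = ρ`**: `ρ` lies in `⟨σ⟩ = Gal(F/ℚ)`, say `ρ = σᵐ` with `m < 10`, and `σᵐ` has order `2` iff
`m = 5`. [cite: Dodson1984, §1.1] -/
theorem pow_five_eq_conjGal (h10 : Module.finrank ℚ F = 10) {σ : F ≃ₐ[ℚ] F} (hσ : orderOf σ = 10) :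
    σ ^ 5 = conjGal := by
  classical
  have htop : Subgroup.zpowers σ = ⊤ :=
    Subgroup.eq_top_of_card_eq _ (by rw [Nat.card_zpowers, hσ, card_gal_eq_ten h10])
  have hmem : (conjGal : F ≃ₐ[ℚ] F) ∈ Submonoid.powers σ := by
    rw [mem_powers_iff_mem_zpowers, htop]; exact Subgroup.mem_top _
  obtain ⟨m, hm⟩ := hmem
  -- reduce the exponent mod `10`
  have hm' : σ ^ (m % 10) = conjGal := by rw [← hm, ← hσ, pow_mod_orderOf]
  have hlt : m % 10 < 10 := Nat.mod_lt _ (by norm_num)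
  have hord : orderOf (σ ^ (m % 10)) = 2 := by rw [hm']; exact orderOf_conjGal
  -- `orderOf (σ^j) = 10 / gcd 10 j`
  have key : ∀ j : ℕ, j < 10 → orderOf (σ ^ j) = 2 → j = 5 := by
    intro j hj h2
    have h := orderOf_pow' σ (n := j) (fun h0 => by rw [h0, pow_zero, orderOf_one] at h2; exact absurd h2 (by norm_num))
    rw [hσ, h2] at h
    interval_cases j <;> first | rfl | (exfalso; revert h; decide)
  rw [← key _ hlt hord, hm']

end Galois

/-! ## §2 Coordinates `p ∘ σⁿ` modulo `10` -/

section Emb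

variable {F : Type} [Field F] [NumberField F] [IsCMField F] [IsGalois ℚ F] (σ : F ≃ₐ[ℚ] F) (p : F →+* ℂ)

omit [IsCMField F] [IsGalois ℚ F] in
/-- `p ∘ σ^{n mod 10} = p ∘ σⁿ` for `σ` of order `10`. [folklore] -/
theorem emb_mod_ten (hσ : orderOf σ = 10) (n : ℕ) : emb σ p (n % 10) = emb σ p n := by
  rw [emb, emb, ← hσ, pow_mod_orderOf]

omit [IsGalois ℚ F] in
/-- Complex conjugation is the shift by `5`: `conj (p ∘ σⁿ) = p ∘ σ^{n+5}` when `σ⁵ = ρ`. [folklore] -/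
theorem conjugate_emb_ten (h5 : σ ^ 5 = conjGal) (n : ℕ) :
    ComplexEmbedding.conjugate (emb σ p n) = emb σ p (n + 5) := by
  rw [conjugate_eq_comp_conjGal, ← h5, emb_comp_pow]

omit [IsCMField F] in
/-- `p ∘ σᵐ = p ∘ σⁿ ↔ m ≡ n (mod 10)`. [folklore] -/
theorem emb_eq_emb_iff_ten (hσ : orderOf σ = 10) (m n : ℕ) : emb σ p m = emb σ p n ↔ m % 10 = n % 10 := by
  constructor
  · intro h
    have hinj := (AndreProductForm.comp_gal_bijective F p).1 (a₁ := σ ^ m) (a₂ := σ ^ n) h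
    rw [← hσ]
    exact pow_inj_mod.mp hinj
  · intro h
    rw [← emb_mod_ten σ p hσ m, h, emb_mod_ten σ p hσ n]

omit [IsCMField F] in
/-- For `[F:ℚ] = 10` and `σ` of order `10`, every complex embedding is `p ∘ σⁿ` with `n < 10`. [folklore] -/
theorem exists_emb_eq_ten (h10 : Module.finrank ℚ F = 10) (hσ : orderOf σ = 10) (φ : F →+* ℂ) :
    ∃ n : ℕ, n < 10 ∧ emb σ p n = φ := by
  classical
  obtain ⟨g, hg⟩ := (AndreProductForm.comp_gal_bijective F p).2 φ
  have htop : Subgroup.zpowers σ = ⊤ :=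
    Subgroup.eq_top_of_card_eq _ (by rw [Nat.card_zpowers, hσ, card_gal_eq_ten h10])
  have hmem : g ∈ Submonoid.powers σ := by
    rw [mem_powers_iff_mem_zpowers, htop]; exact Subgroup.mem_top g
  obtain ⟨n, hn⟩ := hmem
  refine ⟨n % 10, Nat.mod_lt _ (by norm_num), ?_⟩
  rw [← hg, ← hn]
  exact emb_mod_ten σ p hσ n

omit [IsCMField F] [IsGalois ℚ F] in
/-- **Realisers of the translations**: an automorphism of `ℂ` extending `σᵍ` through `p` shifts every coordinate by `g`:
`ρ ∘ (p ∘ σⁿ) = p ∘ σ^{g+n}`. [folklore] -/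
theorem exists_ringEquiv_comp_emb (g : ℕ) :
    ∃ ρ : ℂ ≃+* ℂ, ∀ n : ℕ, (ρ : ℂ →+* ℂ).comp (emb σ p n) = emb σ p (g + n) := by
  haveI : Countable F := Countable.of_equiv _ (Module.finBasis ℚ F).equivFun.toEquiv.symm
  obtain ⟨ρ, hρ⟩ := Motives.ZarhinLie.exists_ringEquiv_complex_comp_eq p (emb σ p g)
  refine ⟨ρ, fun n => RingHom.ext fun x => ?_⟩
  rw [RingHom.coe_comp, Function.comp_apply, emb_apply, RingHom.coe_coe, hρ, emb_apply, emb_apply, pow_add,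
    AlgEquiv.mul_apply]

end Emb

/-! ## §3 The cyclic frame of a Galois decic CM field, and the parity law -/

section Frame

/-- The finite step of the parity law: a `Bool`-valued function on `ℤ/10` which is `1`-periodic is constant, and one which
alternates at every step and vanishes at `0` is the parity indicator. [folklore] -/
theorem parity_of_step :
    (∀ f : ZMod 10 → Bool, (∀ n, f (n + 1) = f n) → ∀ n, f n = f 0) ∧
    (∀ f : ZMod 10 → Bool, f 0 = false → (∀ n, f (n + 1) = !f n) → ∀ n, f n = decide (n.val % 2 = 1)) := by
  constructor
  · intro f hf n
    have key : ∀ m : ℕ, f (m : ZMod 10) = f 0 := by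
      intro m
      induction m with
      | zero => simp
      | succ m ih => rw [Nat.cast_succ, hf, ih]
    have h := key n.val
    rwa [ZMod.natCast_zmod_val] at h
  · intro f h0 hf n
    have key : ∀ m : ℕ, f (m : ZMod 10) = decide (m % 2 = 1) := by
      intro m
      induction m with
      | zero => simpa using h0
      | succ m ih =>
        rw [Nat.cast_succ, hf, ih]
        rcases Nat.mod_two_eq_zero_or_one m with h | h <;> simp [h, Nat.succ_mod_two_eq_one_iff]
    have h := key n.val
    rwa [ZMod.natCast_zmod_val] at h

variable {F : Type} [Field F] [NumberField F] [IsCMField F] [IsGalois ℚ F]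
  {k : Type} [Field k] [NumberField k]

/-- **THE CYCLIC FRAME of a Galois CM field of degree `10`.**  For a generator `σ` of `Gal(F/ℚ)` (`orderOf σ = 10`), a base
embedding `p : F → ℂ`, an imaginary quadratic `k` (`[k:ℚ] = 2`, `τ(δ) = i√d`, `δ² = -d`) with `i : k → F` and `p|_k = τ̄`:
there is a bijection `e : Hom(F, ℂ) ≃ ℤ/10` with `e (p ∘ σⁿ) = n` such that complex conjugation is `+5` (`σ⁵ = ρ`), every
translation `+g` is realised by an automorphism of `ℂ`, and `s|_k = τ ⟺ e s` is ODD (the parity law).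
[cite: Dodson1984, §1.1] [cite: Shimura1998, §8.4] -/
theorem exists_cyclicFrame (h10 : Module.finrank ℚ F = 10) (h2 : Module.finrank ℚ k = 2) {σ : F ≃ₐ[ℚ] F}
    (hσ : orderOf σ = 10) (p : F →+* ℂ) (i : k →+* F) {τ : k →+* ℂ} {δ : 𝓞 k} {d : ℕ} (hd : 0 < d)
    (hτ : τ (δ : k) = Complex.I * (Real.sqrt d : ℂ)) (hp : p.comp i = ComplexEmbedding.conjugate τ) :
    ∃ e : (F →+* ℂ) ≃ ZMod 10, (∀ n : ℕ, e (emb σ p n) = (n : ZMod 10)) ∧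
      (∀ s : F →+* ℂ, s.comp i = τ ↔ (e s).val % 2 = 1) ∧
      (∀ s : F →+* ℂ, e (ComplexEmbedding.conjugate s) = e s + 5) ∧
      (∀ g : ZMod 10, ∃ ρ : ℂ ≃+* ℂ, ∀ s : F →+* ℂ, e ((ρ : ℂ →+* ℂ).comp s) = e s + g) := by
  classical
  have h5 : σ ^ 5 = conjGal := pow_five_eq_conjGal h10 hσ
  -- the bijection `n ↦ p ∘ σⁿ`
  let fr : ZMod 10 → (F →+* ℂ) := fun j => emb σ p j.val
  have hfr_inj : Function.Injective fr := by
    intro a b h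
    have h' := (emb_eq_emb_iff_ten σ p hσ _ _).1 h
    rw [Nat.mod_eq_of_lt (ZMod.val_lt a), Nat.mod_eq_of_lt (ZMod.val_lt b)] at h'
    exact ZMod.val_injective 10 h'
  have hfr_surj : Function.Surjective fr := by
    intro φ
    obtain ⟨n, hn, hφ⟩ := exists_emb_eq_ten σ p h10 hσ φ
    refine ⟨(n : ZMod 10), ?_⟩
    change emb σ p ((n : ZMod 10)).val = φ
    rw [ZMod.val_natCast, Nat.mod_eq_of_lt hn, hφ]
  let e : (F →+* ℂ) ≃ ZMod 10 := (Equiv.ofBijective fr ⟨hfr_inj, hfr_surj⟩).symm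
  have he : ∀ n : ℕ, e (emb σ p n) = (n : ZMod 10) := by
    intro n
    apply (Equiv.ofBijective fr ⟨hfr_inj, hfr_surj⟩).injective
    rw [Equiv.apply_symm_apply]
    change emb σ p n = emb σ p ((n : ZMod 10)).val
    rw [ZMod.val_natCast, emb_mod_ten σ p hσ]
  have hes : ∀ s : F →+* ℂ, emb σ p (e s).val = s := fun s =>
    (Equiv.ofBijective fr ⟨hfr_inj, hfr_surj⟩).apply_symm_apply s
  -- conjugation
  have he_conj : ∀ s : F →+* ℂ, e (ComplexEmbedding.conjugate s) = e s + 5 := by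
    intro s
    conv_lhs => rw [← hes s, conjugate_emb_ten σ p h5, he]
    push_cast
    rw [ZMod.natCast_zmod_val]
  -- realisers
  have he_gal : ∀ g : ZMod 10, ∃ ρ : ℂ ≃+* ℂ, ∀ s : F →+* ℂ, e ((ρ : ℂ →+* ℂ).comp s) = e s + g := by
    intro g
    obtain ⟨ρ, hρ⟩ := exists_ringEquiv_comp_emb σ p g.val
    refine ⟨ρ, fun s => ?_⟩
    conv_lhs => rw [← hes s, hρ, he]
    push_cast
    rw [ZMod.natCast_zmod_val, ZMod.natCast_zmod_val, add_comm]
  -- the parity law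
  have hττ : ComplexEmbedding.conjugate τ ≠ τ := CMThreefoldPair.conjugate_ne_of_apply_eq hd hτ
  have hk : ∀ σ' : k →+* ℂ, σ' = τ ∨ σ' = ComplexEmbedding.conjugate τ := fun σ' => eq_or_eq_conjugate h2 hd hτ σ'
  let f : ZMod 10 → Bool := fun j => decide ((emb σ p j.val).comp i = τ)
  have hf0 : f 0 = false := by
    change decide ((emb σ p (0 : ZMod 10).val).comp i = τ) = false
    rw [ZMod.val_zero, emb_zero, hp]
    exact decide_eq_false hττ
  -- each realiser fixes or swaps the restriction pattern
  have hstep : ∀ g : ZMod 10, (∀ n, f (n + g) = f n) ∨ (∀ n, f (n + g) = !f n) := by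
    intro g
    obtain ⟨ρ, hρ⟩ := exists_ringEquiv_comp_emb σ p g.val
    have hshift : ∀ n : ZMod 10, (emb σ p (n + g).val).comp i = (ρ : ℂ →+* ℂ).comp ((emb σ p n.val).comp i) := by
      intro n
      rw [← RingHom.comp_assoc, hρ, ← emb_mod_ten σ p hσ (g.val + n.val), ← ZMod.val_add, add_comm]
    have hinjρ : ∀ σ₁ σ₂ : k →+* ℂ, (ρ : ℂ →+* ℂ).comp σ₁ = (ρ : ℂ →+* ℂ).comp σ₂ → σ₁ = σ₂ :=
      fun σ₁ σ₂ h => RingHom.ext fun z => ρ.injective (by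
        have e1 := RingHom.congr_fun h z
        simp only [RingHom.coe_comp, RingHom.coe_coe, Function.comp_apply] at e1
        exact e1)
    by_cases hρτ : (ρ : ℂ →+* ℂ).comp τ = τ
    · -- `ρ` fixes `τ`, hence `τ̄`: the pattern is `g`-periodic
      left
      intro n
      have hρτ' : (ρ : ℂ →+* ℂ).comp (ComplexEmbedding.conjugate τ) = ComplexEmbedding.conjugate τ := by
        rcases hk ((ρ : ℂ →+* ℂ).comp (ComplexEmbedding.conjugate τ)) with h | h
        · exact absurd (hinjρ _ _ (h.trans hρτ.symm)) hττ
        · exact h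
      change decide ((emb σ p (n + g).val).comp i = τ) = decide ((emb σ p n.val).comp i = τ)
      rw [hshift]
      rcases hk ((emb σ p n.val).comp i) with h | h <;> rw [h]
      · rw [hρτ]
      · rw [hρτ']
    · -- `ρ` swaps `τ` and `τ̄`: the pattern flips
      right
      intro n
      have hρτ1 : (ρ : ℂ →+* ℂ).comp τ = ComplexEmbedding.conjugate τ := (hk _).resolve_left hρτ
      have hρτ2 : (ρ : ℂ →+* ℂ).comp (ComplexEmbedding.conjugate τ) = τ := by
        rcases hk ((ρ : ℂ →+* ℂ).comp (ComplexEmbedding.conjugate τ)) with h | h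
        · exact h
        · exact absurd (hinjρ _ _ (h.trans hρτ1.symm)) hττ
      change decide ((emb σ p (n + g).val).comp i = τ) = !decide ((emb σ p n.val).comp i = τ)
      rw [hshift]
      rcases hk ((emb σ p n.val).comp i) with h | h <;> rw [h]
      · rw [hρτ1, decide_eq_false hττ]; simp
      · rw [hρτ2, decide_eq_false hττ]; simp
  -- the pattern is not constant: `τ` has an extension to `F`
  have hne : ∃ n, f n = true := by
    have hpos : 0 < (Finset.univ.filter fun s : F →+* ℂ => s.comp i = τ).card := by
      rw [card_filter_comp_eq_five i h10 h2 τ]; norm_num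
    obtain ⟨s, hs⟩ := Finset.card_pos.1 hpos
    refine ⟨e s, ?_⟩
    change decide ((emb σ p (e s).val).comp i = τ) = true
    rw [hes s]
    exact decide_eq_true (Finset.mem_filter.1 hs).2
  have halt : ∀ n, f (n + 1) = !f n := by
    rcases hstep 1 with h | h
    · exfalso
      obtain ⟨n, hn⟩ := hne
      rw [parity_of_step.1 f h n, hf0] at hn
      exact Bool.false_ne_true hn
    · exact h
  have hparity : ∀ n, f n = decide (n.val % 2 = 1) := parity_of_step.2 f hf0 halt
  refine ⟨e, he, fun s => ?_, he_conj, he_gal⟩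
  have h := hparity (e s)
  change decide ((emb σ p (e s).val).comp i = τ) = decide ((e s).val % 2 = 1) at h
  rw [hes s] at h
  constructor
  · intro hs
    rw [decide_eq_true hs] at h
    exact of_decide_eq_true h.symm
  · intro hodd
    rw [decide_eq_true hodd] at h
    exact of_decide_eq_true h

end Frame

end Summit.HodgeConjecture.CorCM.DecicCurveFivefold

end
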